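import Mathlib
import HarnessLib
import HarnessLib.Audit
import Summits.CriticalPhenomena.Statement

/-!
Route: PercThresholdOne

It suffices to show X_T1 = NoFragileGiantLocalRule [card
CriticalPhenomena/PercolationContinuityZ3/critical-cluster-threshold-one; "the critical cluster
cannot exist because percolation would be impossible on it"]:
no LOCAL MONOTONE RULE produces a fragile weaving giant on Z^3. Precisely: let U = (U_e) be i.i.d.
uniform labels on the edges of Z^3 (labelMeasure) and F a measurable map labels -> bond
configurations that is ANTITONE (lower labels, more edges), EQUIVARIANT under translations,
coordinate permutations and a coordinate reflection, supported on nearest-neighbour edges, and of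
FINITE RANGE R (the status of e depends only on labels within sup-distance R of e). If a.s. the
configuration xi = F(U) has at most one infinite cluster (UNIQ), every cluster of xi restricted to
every coordinate half-space {z_i >= k} / {z_i <= k} is finite (WEAVE), and P(C_xi(0) infinite) > 0
(DENSE), then xi is NOT exponentially fragile: it is false that for every q < 1 the independent
q-thinning xi ∩ eta_q has P(0 <-> dB(n) in xi ∩ eta_q) <= exp(-c(q) n) for all n (FRAG).
Assembly (every input PROVED in tree): if theta(p_c) > 0 take F(U) = configOfLabels p_c U (zdGraph
3), R = 1: antitone, equivariant, n.n., range 1; its law is P_{p_c} (map_configOfLabels_holds); UNIQ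
a.s. (Grimmett1999_numInfiniteClusters_le_one_holds), WEAVE a.s. (BarskyGrimmettNewman1991_Z3_holds
+ lattice symmetry), DENSE (= theta(p_c) > 0); but FRAG holds: xi ∩ eta_q has law P_{q p_c}
(thinning of the monotone coupling) and q p_c < p_c gives exp decay (perc_sharpness_holds,
criticalProb > 0). Contradiction, so theta(p_c) = 0 = PercolationContinuityZ3
(percolationContinuityZ3_iff). So X_T1 -> PercolationContinuityZ3.
The route is a LADDER of class-level structure theorems ordered by the input structure they grant
the prover: NoFragileGiantFKG (stationary + positively associated laws; r3) =>
NoFragileGiantMonotoneFactor (antitone equivariant factors of iid labels, any range; r2) => X_T1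
(finite range; target) => theta(p_c)=0; plus the card's isoperimetric leg SamePAnchoredIsoperimetry
(r4) closing through the generalised Cerf–Dembin vanishing-profile theorem (support, provable now)
and BGN.
Lean (X_T1, elaborates, planner Sketch.lean rc 0; LAB = Sym2 (Fin 3 → ℤ) → ℝ, CFG = Set (Sym2 (Fin 3
→ ℤ)) = BondConfig (Site 3), mu = labelMeasure (Fin 3 → ℤ)):
∀ (F : LAB → CFG) (R : ℕ), (Measurable F ∧ Antitone F ∧ (∀ U, F U ⊆ (zdGraph 3).edgeSet) ∧ (∀ g :
Site 3 → Site 3, (g a translation ∨ a coordinate permutation ∨ the reflection x ↦ update x 0 (-x 0))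
→ ∀ U, F (U ∘ Sym2.map g) = Sym2.map g ⁻¹' F U)) → (∀ U U' e, (∀ f, (∀ x ∈ e, ∀ y ∈ f, y - x ∈ box 3
R) → U f = U' f) → (e ∈ F U ↔ e ∈ F U')) → (∀ᵐ U ∂mu, UNIQ (F U) ∧ WEAVE (F U)) → 0 < mu.real {U |
(openCluster (F U) 0).Infinite} → ¬ (∀ q : unitInterval, (q:ℝ) < 1 → ∃ c > 0, ∀ n, (mu.prod
(bondPercolation (zdGraph 3) q)).real {π | F π.1 ∩ π.2 ∈ siteToBoundary 3 n} ≤ Real.exp (-c * n))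
with UNIQ ξ := ∀ x y, (openCluster ξ x).Infinite → (openCluster ξ y).Infinite → y ∈ openCluster ξ x
and WEAVE ξ := ∀ (i : Fin 3) (k : ℤ) (x : Site 3), {y | ξ ∈ openConnIn {z | k ≤ z i} x y}.Finite ∧
{y | ξ ∈ openConnIn {z | z i ≤ k} x y}.Finite (full text in the Target item).

Rationale: WHY THIS LINE. If theta(p_c) = theta* > 0, the critical configuration omega_{p_c} is a stationary,
positively associated bond field with a unique dense infinite cluster that is (i) WEAVING — every
half-space cluster is finite (BarskyGrimmettNewman1991 = Grimmett1999 Thm 7.35, PROVED in tree) —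
and (ii) exactly THRESHOLD-ONE — Bernoulli(q) thinning of omega_{p_c} is omega_{q p_c}, subcritical
and sharp (DuminilCopinTassionCMP2016; perc_sharpness_holds): the q=1 'fragility' of BLPS
(LyonsPeres2016 Thm 8.21 proof, Thm 11.20) and of Benjamini–Häggström–Schramm's question
(BenjaminiHaggstromSchramm2000; BenjaminiTassion2017 §1.2 Q1, read). The card proposes to kill this
object by a STRUCTURE THEOREM for random nearest-neighbour subgraphs of Z^3. Planner's analysis
(NOTES.md): (a) the uniform spanning tree of Z^3 (Pemantle1991: a single tree for d<=4;
BenjaminiEtAl2001: one end) is a stationary, dense (spanning), weaving (symmetry + tail triviality +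
one end), EXPONENTIALLY fragile (a tree inside Z^3 has <= (2m+1)^3 vertices at tree distance m)
giant, so every hypothesis of the dossier except positive association / monotone-factor structure is
CONSISTENT and that structure is load-bearing (UST is negatively associated); (b) association alone
yields no geometry (stationary Bernoulli wall hierarchies with sparse pores are associated, dense,
uniquely percolating, without linear in-box connectivity), so the structure theorem is a genuine
bet, filed as a LADDER by the input structure granted to the prover, each rung with its own tools
and its own Potemkin: r3 NoFragileGiantFKG (Harris-type inequalities only; BT-Q1 with association +
weaving) => r2 NoFragileGiantMonotoneFactor (antitone equivariant factors of iid labels: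
Russo/OSSS/BK and insertion tolerance of the INPUT, rule-agnostic) => target NoFragileGiantLocalRule
(finite range: block/renormalisation tools; 'continuous transitions for local monotone rules') =>
conjunct (threshold rule, range 1; assembly on PROVED tree facts only). (c) The card's isoperimetric
engine survives as r4 SamePAnchoredIsoperimetry: CerfDembin2020 Thm 1.2 (read in full) uses ONLY
translation invariance + half-space finiteness + a deterministic exploration, hence holds for every
stationary weaving random subgraph (support StationaryWeavingVanishingProfile, provable now); with
it, same-p anchored 3-isoperimetry of percolating clusters (Dembin2020 Thm 1.1, Pete2008 for p >
p_c) contradicts the jump. Areas imported: invariant percolation / mass transport (LyonsPeres2016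
ch. 8), factor-of-iid and dependent percolation (LiggettSchonmannStacey1997), anchored isoperimetry
of random graphs (Pete2008, Dembin2020, Hutchcroft2023), UST theory for the negative floor
(Pemantle1991, BenjaminiEtAl2001).
RANKED CRUXES. #2 NoFragileGiantMonotoneFactor — no antitone, lattice-equivariant, measurable factor
F of iid edge labels whose configuration F(U) a.s. has a unique infinite cluster, weaves and is
dense can be exponentially fragile under every independent thinning (why it might fail: an
increasing INFINITE-range factor with a discontinuous transition — mutual/multiplex or k-core
cascades, spiral-type jamming automata arXiv:0709.0583 — whose critical giant weaves in d=3; none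
known on Z^3; sources BenjaminiTassion2017, LyonsPeres2016). #3 NoFragileGiantFKG — the same for any
stationary (translations, coordinate permutations, a reflection), positively associated law on n.n.
bond configurations (why it might fail: an FKG Potemkin — cf. cards fkg-kills-fragility,
potemkin-weaver; BenjaminiHaggstromSchramm2000's insertion-tolerant p_c=1 example is excluded by
density, UST by association; sources BenjaminiTassion2017 Q1, HaggstromMester2009). #4
SamePAnchoredIsoperimetry — theta(p) > 0 => a.s. on {C(0) infinite}, liminf_n n*phihat_n > 0
(anchored 3-dimensional edge-isoperimetry of C(0) measured with OPEN boundary edges,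
CerfDembin2020's phihat_n) (why it might fail: conjunct-equivalent given CerfDembin2020 + BGN, so
only a p-blind proof counts, and every printed proof — Pete2008, Dembin2020 — renormalises at p >
p_c: SprinklingRenormalisation head-on; implies PercHalfSpace's X_P1). Target #0
NoFragileGiantLocalRule = #2 restricted to finite-range F (why it might fail: a finite-range
antitone equivariant rule on Z^3 with a first-order percolation transition and a weaving critical
giant — no such rule is known, cascade examples need unbounded range).
KILL CRITERIA. Target refuted (a local monotone rule with a fragile weaving giant) => close refuted:
the structural line is dead at every rung and the witness is a first-class barrier. #3 refuted alone
=> drop #3, file barrier 'FragileGiantFKG', continue on #2/target. #2 refuted => drop #2 and #3; the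
route lives on target + #4; if #4 is also judged unreachable p-blind (refuter census) => close
exhausted with the supports as dossier evidence for sibling routes (PercHalfSpace,
PercLowPointHalfSpace, porous-core card).
NOT DECOMPOSED YET. Any engine for #2 (candidate split after the supports land: OSSS/decision-tree
sharpness for the thinning family q -> F(U) ∩ eta_q + weaving => a half-space one-arm rate =>
contradiction with density via the generalised Dembin exploration); quantitative weaving (half-space
one-arm exponents) — belongs to PercLowPointHalfSpace; box-shattering (card D4) — rests on the
unproved free-box folklore theorem (cards free-box-*), left out; card r4 'anchored isoperimetry =>
p_c<1' — FALSE in Z^3 (LyonsPeres2016 Ex 6.87; fkg-kills-fragility S1), not filed; Teixeira2015's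
local criterion — a theorem inapplicable to random H, not filed; the negation of #3 is not a
separate item (a proof of it closes #3 as refuted). Prior programme: not consulted (plancard mode).
CHEAPEST FALSIFIER. For #3: decorate the UST/Potemkin-weaver skeleton by a monotone coupling
(Bernoulli(1/2) on a random associated sponge) and test association of two wall indicators at one
separation — a single covariance sign computation (fkg-kills-fragility (S2) says where); for
#2/target: check whether the mutual giant of two independent Bernoulli(p) layers on Z^3 (an
increasing infinite-range factor) has a discontinuous transition with half-space-finite critical
giant (numerics exist: Grassberger 2015, multiplex book baxter2021) — if a FINITE truncation of the
cascade already jumps, the target is dead; for #4: none cheaper than the conjunct (it is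
conjunct-equivalent) — attack via the p-blindness census of Pete2008's exponential cluster
repulsion.
SUPPORT. rank 9, provable now unless noted: FKGImpliesMonotoneFactor (#3 => #2: pushforward of
labelMeasure, Harris for iid uniform labels, equivariance => invariance);
StationaryWeavingVanishingProfile (generalised CerfDembin2020 Thm 1.2: stationary + weaving =>
liminf n*phihat_n = 0 a.s.); IsoperimetricClosing (that + CriticalConfigWeaves + #4 => conjunct);
CriticalConfigWeaves (BGN_Z3 + lattice symmetry: at p_c all half-space clusters finite, all
axes/offsets/base points); ThinningLaw (configOfLabels p U ∩ eta_q has law P_{q p});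
FragileWeavingGiantExists (negative floor, UST witness; needs UST facts not in tree — Pemantle1991,
BenjaminiEtAl2001, Wilson's algorithm — grounders may stamp it citeable). #2 => target is a one-line
specialisation (no item).
DEFINITION REQUESTS. none: every signature is over existing declarations (labelMeasure,
configOfLabels, bondPercolation, openCluster, openConnIn, siteToBoundary, box, edgeBoundary); the
recurring blocks UNIQ/WEAVE/FRAG are inlined — a Literature definition `IsWeaving`,
`IsThinningFragile` (topic Literature/Probability/Percolation) would shorten all rungs and is
suggested, not required.

Novelty: Nearest prior art FOUND: BenjaminiTassion2017 §1.2 Question 1 with BenjaminiHaggstromSchramm2000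
(the invariant finite-energy p_c(X)=1 question, tied by BHS to theta(p_c)=0; arXiv:1505.06069 pp.1-4
read); LyonsPeres2016 Thm 8.21/Prop 8.22 and Thm 11.20 (fragility p_c(omega')=1 as a proof device),
Ex 6.87 (anchored isoperimetry without p_c<1); CerfDembin2020 Thm 1.2 (arXiv:1903.08065 read in
full: liminf n*phihat_n(p_c)=0 a.s.) and Dembin2020 Thm 1.1 (profile exists, positive, p>p_c);
Pete2008; Hutchcroft2023 (isoperimetry/transience down to p_c 'remains open'); HaggstromMester2009
(soft-axiom counterexample genre); Teixeira2015. Delta, one sentence: replace BT-Q1's finite energy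
by the structure the critical cluster provably has — an antitone, lattice-equivariant, FINITE-RANGE
factor of iid labels that weaves (BGN) and is sharply thinning-fragile — obtaining a ladder of class
statements FKG => monotone factor => local rule => theta(p_c)=0 whose bottom rung is a universality
statement for local monotone rules with an assembly on PROVED tree facts only, plus two observations
not found in print: Cerf–Dembin's vanishing-profile proof is measure-theoretic (stationarity +
weaving), which makes 'same-p anchored isoperimetry' a closable crux, and UST(Z^3) is a stationary
dense weaving exponentially-fragile giant, so association/monotonicity is exactly the load-bearing
hypothesis. Searches 2026-08-15: lit read arXiv:1903.08065 (pp.1-7), arXiv:1505.06069 (pp.1-4);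
crossref 'homogenizat  [refs: 1505.06069, 1903.08065, book:baxter2021-weak-multiplex-percolation, BenjaminiTassion2017, BenjaminiHaggstromSchramm2000, LyonsPeres2016, CerfDembin2020, Dembin2020, Pete2008, Hutchcroft2023, HaggstromMester2009, Teixeira2015, Grimmett1999]

Barriers (technique_class: structure-theorem monotone-factor-of-iid isoperimetry): - technique_class: structure-theorem monotone-factor-of-iid invariant-percolation
anchored-isoperimetry
- Literature.Barriers.CriticalPhenomena.AmenableInvariantPercolation: engaged, not violated — no
size-blind density threshold is asserted; every rung carries UNIQ + DENSE (LP Thm 8.37 witnesses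
have only finite clusters) and weaving + thinning-fragility + (rungs 2, 0) monotone-factor
structure, none of which the Følner-set witnesses address; mass transport enters only through the
profile bound lintegral_bdryRatio_le_zd-type bookkeeping in proofs.
- Literature.Barriers.CriticalPhenomena.LongRangeDiscontinuity: evaded by typing — every rung
quantifies over NEAREST-NEIGHBOUR configurations (F U ⊆ (zdGraph 3).edgeSet, resp. ξ ⊆ edgeSet a.s.)
and WEAVE is a half-space notion of Z^3; the Aizenman–Newman 1/r^2 critical cluster is fragile and
associated but not an n.n. subgraph, so it is not a counterexample to any rung.
- Literature.Barriers.CriticalPhenomena.RandomClusterFirstOrder: consistent — the wired q>Q critical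
giant is THICK (percolates after thinning, Pirogov–Sinai) and percolates in half-spaces, so it
satisfies neither FRAG nor WEAVE; the thinning identity (ThinningLaw) is a product-measure fact used
only in the assembly at q=1.
- Literature.Barriers.CriticalPhenomena.TreesPercolatingAtCriticality: its moral inside Z^3 is the
UST witness (support FragileWeavingGiantExists): tree-like fragile weaving giants exist, which is
why association / monotone-factor structure is a

History (route lifecycle, newest last):
- 2026-08-16T03:58:59Z · AUTO-CRUX (backfill): NoFragileGiantLocalRule — hypotheses of the deciding theorem that nothing in the route derives are cruxes (operator:999:1085951)
- 2026-08-22T06:24:34Z · DORMANT — reconciler: no traction for 5.1 d (last activity item-evidence-added at 2026-08-17T02:38:54Z); parked, not closed — `ledger route dormant route-CriticalPhenomen (operator:999:2703437)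
- 2026-08-26T03:39:59Z · REACTIVATED — reconciler: reactivated — activity statement-closed at 2026-08-25T23:47:02Z after parking at 2026-08-22T06:24:34Z (operator:999:2544102)

sub-problem: PercolationContinuityZ3 · status: open · opened planner-plancard-CriticalPhenomena-Percolatio-e45951ae-0 2026-08-15T11:40:33Z · rev 3 · ledger route-CriticalPhenomena-PercThresholdOne
GENERATED by the gate from the ledger (D-0016/17). Provers cite these decls: `theorem foo : Summit.CriticalPhenomena.PercolationContinuityZ3.Theses.PercThresholdOne.<Decl> := …` in Summits/CriticalPhenomena/PercolationContinuityZ3/Theorems/<Name>.lean.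
-/

namespace Summit.CriticalPhenomena.PercolationContinuityZ3.Theses.PercThresholdOne

open scoped BigOperators Topology Manifold Classical MeasureTheory ProbabilityTheory Matrix InnerProductSpace ComplexConjugate ContinuousMap
open Filter Set Function TopologicalSpace MeasureTheory

attribute [summit_statement] _root_.PercolationContinuityZ3

/-- item stmt-CriticalPhenomena-5256 · crux (kind.auto-crux: conjecture-grade) · rank 0 · open · by planner
why it might fail: A finite-range antitone equivariant rule on ℤ³ with a unique dense weaving giant, exponentially subcritical after every thinning, refutes it; none known — rigorous monotone jumps (spiral model; fkg-weaver design) need unbounded range; 3D interdependent-lattice numerics (arXiv:1502.01623) continuous.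
sources: BenjaminiTassion2017, BenjaminiHaggstromSchramm2000, LyonsPeres2016, LiggettSchonmannStacey1997, arXiv:0709.0583, arXiv:1502.01623
[target] X_T1 'no local monotone rule makes a fragile weaving giant': for every measurable ANTITONE
(lower labels => more edges) map F from iid uniform edge labels U (labelMeasure (Site 3)) to
nearest-neighbour bond configurations of Z^3, EQUIVARIANT under translations, coordinate
permutations and the reflection x ↦ update x 0 (-x 0), of FINITE RANGE R (e's status depends only on
labels of edges within sup-distance R of both endpoints of e): if a.s. F(U) has at most one infinite
cluster (UNIQ), all clusters of F(U) inside every coordinate half-space {z_i >= k}, {z_i <= k} are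
finite (WEAVE), and P(C_{F(U)}(0) infinite) > 0 (DENSE), then NOT FRAG, where FRAG := for every q <
1 there is c > 0 with (labelMeasure ⊗ P_q){0 <-> dB(n) inside B(n) using edges of F(U) ∩ eta} <=
exp(-c n) for all n (exponential subcriticality of every independent thinning). Instances: F =
threshold rule at p (R = 1) gives omega_p; real world: p > p_c violates FRAG-hypothesis side
consistently (not fragile), p <= p_c has no infinite cluster. A universality statement ('no
first-order transition with weaving giant for local monotone rules'); strictly weaker than #2
(one-line specialisation) and than #3. [deps: -/
@[route_item "route-CriticalPhenomena-PercThresholdOne"]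
def NoFragileGiantLocalRule : Prop :=
  ∀ (F : (Sym2 (Fin 3 → ℤ) → ℝ) → Set (Sym2 (Fin 3 → ℤ))) (R : ℕ), (Measurable F ∧ Antitone F ∧ (∀ U, F U ⊆ (Literature.Probability.LatticeModels.zdGraph 3).edgeSet) ∧ (∀ g : (Fin 3 → ℤ) → (Fin 3 → ℤ), ((∃ a, g = (· + a)) ∨ (∃ σ : Equiv.Perm (Fin 3), g = fun x j => x (σ j)) ∨ g = fun x => Function.update x 0 (-x 0)) → ∀ U, F (U ∘ Sym2.map g) = Sym2.map g ⁻¹' F U)) → (∀ U U' e, (∀ f, (∀ x ∈ e, ∀ y ∈ f, y - x ∈ Literature.Probability.LatticeModels.box 3 R) → U f = U' f) → (e ∈ F U ↔ e ∈ F U')) → (∀ᵐ U ∂(Literature.Probability.Percolation.labelMeasure (Fin 3 → ℤ)), (∀ x y, (Literature.Probability.Percolation.openCluster (F U) x).Infinite → (Literature.Probability.Percolation.openCluster (F U) y).Infinite → y ∈ Literature.Probability.Percolation.openCluster (F U) x) ∧ (∀ (i : Fin 3) (k : ℤ) x, {y | (F U) ∈ Literature.Probability.Percolation.openConnIn {z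 | k ≤ z i} x y}.Finite ∧ {y | (F U) ∈ Literature.Probability.Percolation.openConnIn {z | z i ≤ k} x y}.Finite)) → 0 < (Literature.Probability.Percolation.labelMeasure (Fin 3 → ℤ)).real {U | (Literature.Probability.Percolation.openCluster (F U) 0).Infinite} → ¬ (∀ q : unitInterval, (q : ℝ) < 1 → ∃ c : ℝ, 0 < c ∧ ∀ n : ℕ, ((Literature.Probability.Percolation.labelMeasure (Fin 3 → ℤ)).prod (Literature.Probability.Percolation.bondPercolation (Literature.Probability.LatticeModels.zdGraph 3) q)).real {π | F π.1 ∩ π.2 ∈ Literature.Probability.Percolation.siteToBoundary 3 n} ≤ Real.exp (-c * n))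

/-- item stmt-CriticalPhenomena-5258 · crux · rank 2 · open · by planner
why it might fail: An increasing infinite-range image of iid labels with a dense unique weaving giant, exponentially subcritical under every thinning, refutes it; the multi-parent near-critical tube hierarchy of card fkg-weaver-monotone-dag (route PercPotemkinWeaver) targets it; monotone culling rules can jump.
sources: BenjaminiTassion2017, BenjaminiHaggstromSchramm2000, LyonsPeres2016, HaggstromMester2009, arXiv:0709.0583, arXiv:1502.01623
[crux] r2 — RULE-AGNOSTIC BERNOULLI LEVEL: the target without the finite-range hypothesis: no
measurable antitone lattice-equivariant factor F of iid uniform edge labels (any range) has F(U)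
a.s. UNIQ ∧ WEAVE, DENSE, and FRAG (exponentially subcritical under every independent q-thinning,
q<1). This is the class in which the critical cluster's actual structure lives (E(C_{p_c}) =
increasing equivariant image of the labels) and in which Russo/OSSS/BK, insertion tolerance OF THE
INPUT and Harris (hence association) are all available, but the specific threshold rule is not: a
proof here = 'theta(p_c)=0 by rule-agnostic Bernoulli technology'. Implies the target by
specialisation (one line); implied by #3 via support FKGImpliesMonotoneFactor. Candidate engine (not
decomposed): OSSS sharpness for the monotone thinning family q ↦ F(U) ∩ eta_q at its endpoint q=1
combined with WEAVE through the generalised Dembin exploration (support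
StationaryWeavingVanishingProfile gives: every such F(U) has VANISHING anchored 3-profile a.s.).
Calibration: UST(Z^3) satisfies everything except being a monotone factor (it is negatively
associated) — support FragileWeavingGiantExists. Sources: BenjaminiTassi -/
@[route_item "route-CriticalPhenomena-PercThresholdOne"]
def NoFragileGiantMonotoneFactor : Prop :=
  ∀ F : (Sym2 (Fin 3 → ℤ) → ℝ) → Set (Sym2 (Fin 3 → ℤ)), (Measurable F ∧ Antitone F ∧ (∀ U, F U ⊆ (Literature.Probability.LatticeModels.zdGraph 3).edgeSet) ∧ (∀ g : (Fin 3 → ℤ) → (Fin 3 → ℤ), ((∃ a, g = (· + a)) ∨ (∃ σ : Equiv.Perm (Fin 3), g = fun x j => x (σ j)) ∨ g = fun x => Function.update x 0 (-x 0)) → ∀ U, F (U ∘ Sym2.map g) = Sym2.map g ⁻¹' F U)) → (∀ᵐ U ∂(Literature.Probability.Percolation.labelMeasure (Fin 3 → ℤ)), (∀ x y, (Literature.Probability.Percolation.openCluster (F U) x).Infinite → (Literature.Probability.Percolation.openCluster (F U) y).Infinite → y ∈ Literature.Probability.Percolation.openCluster (F U) x) ∧ (∀ (i : Fin 3) (k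 : ℤ) x, {y | (F U) ∈ Literature.Probability.Percolation.openConnIn {z | k ≤ z i} x y}.Finite ∧ {y | (F U) ∈ Literature.Probability.Percolation.openConnIn {z | z i ≤ k} x y}.Finite)) → 0 < (Literature.Probability.Percolation.labelMeasure (Fin 3 → ℤ)).real {U | (Literature.Probability.Percolation.openCluster (F U) 0).Infinite} → ¬ (∀ q : unitInterval, (q : ℝ) < 1 → ∃ c : ℝ, 0 < c ∧ ∀ n : ℕ, ((Literature.Probability.Percolation.labelMeasure (Fin 3 → ℤ)).prod (Literature.Probability.Percolation.bondPercolation (Literature.Probability.LatticeModels.zdGraph 3) q)).real {π | F π.1 ∩ π.2 ∈ Literature.Probability.Percolation.siteToBoundary 3 n} ≤ Real.exp (-c * n))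

/-- item stmt-CriticalPhenomena-5259 · crux · rank 3 · open · by planner
why it might fail: Only Harris-type inequalities are available; an FKG Potemkin (stationary associated n.n. law, dense unique weaving giant, exponentially subcritical under every thinning) refutes it — fkg-weaver design, or product-mixtures on an associated multiscale sponge (fkg-kills-fragility S2); BT2017 Q1 open.
sources: BenjaminiTassion2017, BenjaminiHaggstromSchramm2000, HaggstromMester2009, LyonsPeres2016, Literature.Barriers.CriticalPhenomena.AmenableInvariantPercolation_assoc, Summit.CriticalPhenomena.PercolationContinuityZ3.Theses.PercPotemkinWeaver.FKGHalfSpaceRigidity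
[crux] r3 — CORRELATION-INEQUALITY LEVEL (Benjamini–Tassion Question 1 with association + weaving in
place of finite energy): for no probability measure ν on bond configurations of Z^3 that is
invariant under translations, coordinate permutations and the reflection of coordinate 0, POSITIVELY
ASSOCIATED (ν(A ∩ B) ≥ ν(A) ν(B) for increasing measurable A, B), a.s. supported on n.n. edges with
UNIQ ∧ WEAVE, and DENSE, does FRAG hold (ν ⊗ P_q-exponential decay of the thinned one-arm for every
q < 1). Strongest rung: implies #2 (support FKGImpliesMonotoneFactor). Refuter-facing: a proof of
the NEGATION (an explicit FKG fragile weaving giant) closes this item refuted, is wanted as barrier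
'FragileGiantFKG' (Literature/Barriers/CriticalPhenomena), and by the KILL CRITERIA only drops this
rung. Known non-examples: LP Thm 8.37 Følner witnesses (finite clusters only: fail UNIQ+DENSE),
random-cluster q>Q wired critical giant (thick: fails FRAG and WEAVE), BenjaminiHaggstromSchramm2000
sparse insertion-tolerant X (fails DENSE), UST(Z^3) (fails association), Bernoulli wall hierarchies
with pores (not fragile). Sources: BenjaminiTassion2017 §1.2 Q1 (read);
BenjaminiHaggstromSchramm2000; Haggstro -/
@[route_item "route-CriticalPhenomena-PercThresholdOne"]
def NoFragileGiantFKG : Prop :=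
  ∀ ν : MeasureTheory.Measure (Set (Sym2 (Fin 3 → ℤ))), MeasureTheory.IsProbabilityMeasure ν → (∀ g : (Fin 3 → ℤ) → (Fin 3 → ℤ), ((∃ a, g = (· + a)) ∨ (∃ σ : Equiv.Perm (Fin 3), g = fun x j => x (σ j)) ∨ g = fun x => Function.update x 0 (-x 0)) → ∀ A : Set (Set (Sym2 (Fin 3 → ℤ))), MeasurableSet A → ν ((fun ξ => Sym2.map g ⁻¹' ξ) ⁻¹' A) = ν A) → (∀ A B : Set (Set (Sym2 (Fin 3 → ℤ))), IsUpperSet A → IsUpperSet B → MeasurableSet A → MeasurableSet B → ν.real A * ν.real B ≤ ν.real (A ∩ B)) → (∀ᵐ ξ ∂ν, ξ ⊆ (Literature.Probability.LatticeModels.zdGraph 3).edgeSet ∧ (∀ x y, (Literature.Probability.Percolation.openCluster ξ x).Infinite → (Literature.Probability.Percolation.openCluster ξ y).Infinite → y ∈ Literature.Probability.Percolation.openCluster ξ x) ∧ (∀ (i : Fin 3) (k : ℤ) x, {y | ξ ∈ Literature.Probability.Percolation.openConnIn {z | k ≤ z i} x y}.Finite ∧ {y | ξ ∈ Literature.Probability.Percolation.openConnIn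 {z | z i ≤ k} x y}.Finite)) → 0 < ν.real {ξ | (Literature.Probability.Percolation.openCluster ξ 0).Infinite} → ¬ (∀ q : unitInterval, (q : ℝ) < 1 → ∃ c : ℝ, 0 < c ∧ ∀ n : ℕ, (ν.prod (Literature.Probability.Percolation.bondPercolation (Literature.Probability.LatticeModels.zdGraph 3) q)).real {π | π.1 ∩ π.2 ∈ Literature.Probability.Percolation.siteToBoundary 3 n} ≤ Real.exp (-c * n))

/-- item stmt-CriticalPhenomena-5260 · crux · rank 4 · closed · proved by Summit.CriticalPhenomena.PercolationContinuityZ3.Theorems.PercThresholdOneSamePAnchoredIsoperimetry.samePAnchoredIsoperimetry_proof @ e3adfb88822d (prover) · by planner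
why it might fail: False iff θ(p_c(ℤ³))>0: with in-tree CerfDembin2020_thm12_dim_three it implies the conjunct and CerfDembin2020_thm11 (Dembin2020 Thm 1.1) gives it back — conjunct-equivalent; as a line it needs a p-blind isoperimetric proof, but Pete2008/Dembin2020 coarse-grain at p>p_c (SprinklingRenormalisation).
sources: CerfDembin2020, Dembin2020, Pete2008, Hutchcroft2023, GrimmettMarstrand1990, Literature.Probability.Percolation.CerfDembin2020_thm12_dim_three
[crux] r4 — THE CARD'S ISOPERIMETRIC LEG (r3 of the card with delta = d = 3; r4 of the card is false
and dropped): for every p with theta(p) > 0, P_p-a.s. on {C(0) infinite} there are c > 0 and N with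
c·|K| ≤ n·|∂°K| for all n ≥ N and all 'valid' K (0 ∈ K, K connected to 0 by open paths inside K, |K|
≤ n^3), where ∂°K = OPEN lattice edges with exactly one endpoint in K (= ∂_{C(0)} K,
CerfDembin2020's phihat_n); i.e. liminf_n n·phihat_n > 0. A THEOREM for p > p_c (Dembin2020 Thm 1.1:
n·phi_n → phi(p) > 0; Pete2008), content only at a percolating p_c, where CerfDembin2020 Thm 1.2
gives liminf = 0 a.s.; closing = support IsoperimetricClosing (GenDembin + CriticalConfigWeaves +
this ⇒ conjunct). Via the generalised Dembin exploration this crux IMPLIES PercHalfSpace's thesis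
X_P1 (same-p half-space percolation) — recorded for that route's tenure; it is filed here because
the isoperimetric formulation is this card's and because Pete2008's 'exponential cluster repulsion'
is the one supercritical engine whose same-p input (repulsion of large finite clusters from C_∞ at
p) is not obviously sprinkled. Sources: CerfDembin2020 Thm 1.2 (read in full), Dembin2020 Thm 1.1,
Pete2008, Hutchcroft202 -/
@[route_item "route-CriticalPhenomena-PercThresholdOne"]
def SamePAnchoredIsoperimetry : Prop :=
  ∀ p : unitInterval, 0 < Literature.Probability.Percolation.theta (Literature.Probability.LatticeModels.zdGraph 3) 0 p → ∀ᵐ ω ∂(Literature.Probability.Percolation.bondPercolation (Literature.Probability.LatticeModels.zdGraph 3) p), (Literature.Probability.Percolation.openCluster ω 0).Infinite → ∃ c : ℝ, 0 < c ∧ ∃ N : ℕ, ∀ n : ℕ, N ≤ n → ∀ K : Finset (Fin 3 → ℤ), (0 : (Fin 3 → ℤ)) ∈ K → (∀ x ∈ K, ω ∈ Literature.Probability.Percolation.openConnIn ↑K 0 x) → K.card ≤ n ^ 3 → c * K.card ≤ (n : ℝ) * ((↑(Literature.Probability.LatticeModels.edgeBoundary (Literature.Probability.LatticeModels.zdGraph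 3) K) ∩ ω : Set (Sym2 (Fin 3 → ℤ))).ncard : ℝ)

-- `SamePAnchoredIsoperimetry` holds: proved by `Summit.CriticalPhenomena.PercolationContinuityZ3.Theorems.PercThresholdOneSamePAnchoredIsoperimetry.samePAnchoredIsoperimetry_proof` @ e3adfb88822d (its module imports this route file, so no `_holds` link can be stated here).

/-- item stmt-CriticalPhenomena-14217 · support · rank 9 · closed · proved by Summit.CriticalPhenomena.PercolationContinuityZ3.Theorems.monotoneFactorImpliesLocalRule_proof @ 67c9ca9d309f (prover) · by planner
sources: BenjaminiTassion2017, LyonsPeres2016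
[support] glue crux #2 ⇒ target, BY NAME (the ladder's last rung, previously left as 'one-line
specialisation, no item', which made the target unreachable from the served cruxes):
NoFragileGiantMonotoneFactor → NoFragileGiantLocalRule. Proof (provable now, 2 lines, checked in the
planner's Sketch.lean against this module): `intro h F R hF _hRange hAS hDense; exact h F hF hAS
hDense` — a finite-range antitone equivariant factor is in particular an antitone equivariant
factor; the range hypothesis is simply dropped. With it, a proof of crux #2 closes the route through
the existing deciding theorem: closes (this h2) h_Assembly. [deps: NoFragileGiantMonotoneFactor,
NoFragileGiantLocalRule] [difficulty: provable-now] -/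
@[route_item "route-CriticalPhenomena-PercThresholdOne"]
def MonotoneFactorImpliesLocalRule : Prop :=
  NoFragileGiantMonotoneFactor → NoFragileGiantLocalRule

-- `MonotoneFactorImpliesLocalRule` holds: proved by `Summit.CriticalPhenomena.PercolationContinuityZ3.Theorems.monotoneFactorImpliesLocalRule_proof` @ 67c9ca9d309f (its module imports this route file, so no `_holds` link can be stated here).

/-- item stmt-CriticalPhenomena-14218 · support · rank 9 · closed · proved by Summit.CriticalPhenomena.PercolationContinuityZ3.Theorems.fkgImpliesLocalRule_proof @ 71fc88d526e0 (prover) · by planner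
sources: BenjaminiTassion2017, Grimmett1999, LyonsPeres2016
[support] glue crux #3 ⇒ target, BY NAME: NoFragileGiantFKG → NoFragileGiantLocalRule. Proof
(provable now GIVEN support FKGImpliesMonotoneFactor, stmt-CriticalPhenomena-5261, whose antecedent
and consequent are by definition the bodies of NoFragileGiantFKG and NoFragileGiantMonotoneFactor —
`(h : FKGImpliesMonotoneFactor) : NoFragileGiantFKG → NoFragileGiantMonotoneFactor := h` elaborates
by unfolding): `fun h3 => ‹MonotoneFactorImpliesLocalRule› (‹FKGImpliesMonotoneFactor› h3)`, 2
lines, checked in the planner's Sketch.lean. Do NOT re-prove the ~250-line pushforward/Harris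
argument here: prove FKGImpliesMonotoneFactor (5261) first and cite its `_holds` theorem. With it, a
proof of crux #3 closes the route: closes (this h3) h_Assembly. [deps: NoFragileGiantFKG,
FKGImpliesMonotoneFactor, MonotoneFactorImpliesLocalRule, NoFragileGiantLocalRule] [difficulty:
provable-now] -/
@[route_item "route-CriticalPhenomena-PercThresholdOne"]
def FKGImpliesLocalRule : Prop :=
  NoFragileGiantFKG → NoFragileGiantLocalRule

-- `FKGImpliesLocalRule` holds: proved by `Summit.CriticalPhenomena.PercolationContinuityZ3.Theorems.fkgImpliesLocalRule_proof` @ 71fc88d526e0 (its module imports this route file, so no `_holds` link can be stated here).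

/-- item stmt-CriticalPhenomena-5261 · support · rank 9 · closed · proved by Summit.CriticalPhenomena.PercolationContinuityZ3.Theorems.fkgImpliesMonotoneFactor_proof (prover) · by planner
sources: Grimmett1999, LyonsPeres2016
[support] glue #3 ⇒ #2 (provable now, ~250 lines): given F as in #2 put ν := (labelMeasure (Site
3)).map F. ν is a probability measure; INVARIANCE: for each listed g, U ↦ U ∘ Sym2.map g preserves
labelMeasure (relabelling of an iid product by the bijection Sym2.map g of Sym2 (Site 3);
Measure.infinitePi is permutation-invariant) and equivariance F (U ∘ Sym2.map g) = Sym2.map g ⁻¹' F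
U transports it; ASSOCIATION: for increasing A, B the preimages F ⁻¹' A, F ⁻¹' B are DECREASING in U
(F antitone), and Harris' lemma for the product measure labelMeasure (iid uniforms; prove by
finite-dimensional approximation from harris_fkg_holds / Grimmett1999 Thm 2.4, or directly by the
standard induction + martingale convergence) gives ν(A ∩ B) ≥ ν(A)ν(B); the a.s. clause, DENSE and
FRAG transport along the map (FRAG: (ν ⊗ P_q) of {π.1 ∩ π.2 ∈ E} = (labelMeasure ⊗ P_q) of {F π.1 ∩
π.2 ∈ E} by Measure.map_prod_map-type identities). Hence #3's conclusion ¬FRAG for ν is ¬FRAG for F. -/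
@[route_item "route-CriticalPhenomena-PercThresholdOne"]
def FKGImpliesMonotoneFactor : Prop :=
  (∀ ν : MeasureTheory.Measure (Set (Sym2 (Fin 3 → ℤ))), MeasureTheory.IsProbabilityMeasure ν → (∀ g : (Fin 3 → ℤ) → (Fin 3 → ℤ), ((∃ a, g = (· + a)) ∨ (∃ σ : Equiv.Perm (Fin 3), g = fun x j => x (σ j)) ∨ g = fun x => Function.update x 0 (-x 0)) → ∀ A : Set (Set (Sym2 (Fin 3 → ℤ))), MeasurableSet A → ν ((fun ξ => Sym2.map g ⁻¹' ξ) ⁻¹' A) = ν A) → (∀ A B : Set (Set (Sym2 (Fin 3 → ℤ))), IsUpperSet A → IsUpperSet B → MeasurableSet A → MeasurableSet B → ν.real A * ν.real B ≤ ν.real (A ∩ B)) → (∀ᵐ ξ ∂ν, ξ ⊆ (Literature.Probability.LatticeModels.zdGraph 3).edgeSet ∧ (∀ x y, (Literature.Probability.Percolation.openCluster ξ x).Infinite → (Literature.Probability.Percolation.openCluster ξ y).Infinite → y ∈ Literature.Probability.Percolation.openCluster ξ x) ∧ (∀ (i : Fin 3) (k : ℤ) x, {y | ξ ∈ Literature.Probability.Percolation.openConnIn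 {z | k ≤ z i} x y}.Finite ∧ {y | ξ ∈ Literature.Probability.Percolation.openConnIn {z | z i ≤ k} x y}.Finite)) → 0 < ν.real {ξ | (Literature.Probability.Percolation.openCluster ξ 0).Infinite} → ¬ (∀ q : unitInterval, (q : ℝ) < 1 → ∃ c : ℝ, 0 < c ∧ ∀ n : ℕ, (ν.prod (Literature.Probability.Percolation.bondPercolation (Literature.Probability.LatticeModels.zdGraph 3) q)).real {π | π.1 ∩ π.2 ∈ Literature.Probability.Percolation.siteToBoundary 3 n} ≤ Real.exp (-c * n))) → (∀ F : (Sym2 (Fin 3 → ℤ) → ℝ) → Set (Sym2 (Fin 3 → ℤ)), (Measurable F ∧ Antitone F ∧ (∀ U, F U ⊆ (Literature.Probability.LatticeModels.zdGraph 3).edgeSet) ∧ (∀ g : (Fin 3 → ℤ) → (Fin 3 → ℤ), ((∃ a, g = (· + a)) ∨ (∃ σ : Equiv.Perm (Fin 3), g = fun x j => x (σ j)) ∨ g = fun x => Function.update x 0 (-x 0)) → ∀ U, F (U ∘ Sym2.map g) = Sym2.map g ⁻¹' F U)) → (∀ᵐ U ∂(Literature.Probability.Percolation.labelMeasure (Fin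 3 → ℤ)), (∀ x y, (Literature.Probability.Percolation.openCluster (F U) x).Infinite → (Literature.Probability.Percolation.openCluster (F U) y).Infinite → y ∈ Literature.Probability.Percolation.openCluster (F U) x) ∧ (∀ (i : Fin 3) (k : ℤ) x, {y | (F U) ∈ Literature.Probability.Percolation.openConnIn {z | k ≤ z i} x y}.Finite ∧ {y | (F U) ∈ Literature.Probability.Percolation.openConnIn {z | z i ≤ k} x y}.Finite)) → 0 < (Literature.Probability.Percolation.labelMeasure (Fin 3 → ℤ)).real {U | (Literature.Probability.Percolation.openCluster (F U) 0).Infinite} → ¬ (∀ q : unitInterval, (q : ℝ) < 1 → ∃ c : ℝ, 0 < c ∧ ∀ n : ℕ, ((Literature.Probability.Percolation.labelMeasure (Fin 3 → ℤ)).prod (Literature.Probability.Percolation.bondPercolation (Literature.Probability.LatticeModels.zdGraph 3) q)).real {π | F π.1 ∩ π.2 ∈ Literature.Probability.Percolation.siteToBoundary 3 n} ≤ Real.exp (-c * n)))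

-- `FKGImpliesMonotoneFactor` holds: proved by `Summit.CriticalPhenomena.PercolationContinuityZ3.Theorems.fkgImpliesMonotoneFactor_proof` (its module imports this route file, so no `_holds` link can be stated here).

/-- item stmt-CriticalPhenomena-5262 · support · rank 9 · closed · proved by Summit.CriticalPhenomena.PercolationContinuityZ3.Theorems.stationaryWeavingVanishingProfile_proof @ d88b5d10243f (prover) · by planner
sources: CerfDembin2020, BarskyGrimmettNewman1991
[support] GENERALISED CERF–DEMBIN (provable now, ~500 lines; reusable by every 'counterfactual
cluster' card): for every translation-invariant probability measure ν on bond configurations of Z^3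
a.s. supported on n.n. edges and a.s. WEAVING (all half-space clusters finite), ν-a.s.: for every c
> 0 and N there are n ≥ N and a finite K ∋ 0, connected to 0 inside K by open paths, |K| ≤ n^3, with
n·|∂°K| ≤ c·|K| (∂°K = open edges of the lattice edge boundary of K) — i.e. liminf_n n·phihat_n = 0
(trivial when C(0) is finite: K = C(0)). PROOF = CerfDembin2020 pp.4-7 verbatim with two remarks:
(1) the exploration C_{l+1} = C_l ∪ A_{l+1} and the growth induction |C_{(n-n0)k}| ≥ α n^3 under
inf_{k≥n0} k·phihat_k > c are deterministic; (2) the only probabilistic inputs are E[X_n] ≤ (2n+1)^2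
· ν(∃ open self-avoiding path from 0 of ≥ n vertices inside the half-space {z_0 ≥ 0}) — translation
invariance — and that this probability → 0, which follows from a.s. finiteness of the half-space
cluster of 0 (WEAVE with i, k = 0, x = 0, both orientations; the six faces use the six (i, sign)
instances instead of 'the symmetry of the lattice'). No independence, no FKG. Gives for free: every
configuration -/
@[route_item "route-CriticalPhenomena-PercThresholdOne"]
def StationaryWeavingVanishingProfile : Prop :=
  ∀ ν : MeasureTheory.Measure (Set (Sym2 (Fin 3 → ℤ))), MeasureTheory.IsProbabilityMeasure ν → (∀ (a : (Fin 3 → ℤ)) (A : Set (Set (Sym2 (Fin 3 → ℤ)))), MeasurableSet A → ν ((fun ξ => Sym2.map (· + a) ⁻¹' ξ) ⁻¹' A) = ν A) → (∀ᵐ ξ ∂ν, ξ ⊆ (Literature.Probability.LatticeModels.zdGraph 3).edgeSet ∧ (∀ (i : Fin 3) (k : ℤ) x, {y | ξ ∈ Literature.Probability.Percolation.openConnIn {z | k ≤ z i} x y}.Finite ∧ {y | ξ ∈ Literature.Probability.Percolation.openConnIn {z | z i ≤ k} x y}.Finite)) → ∀ᵐ ξ ∂ν, ∀ c : ℝ,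 0 < c → ∀ N : ℕ, ∃ n : ℕ, N ≤ n ∧ ∃ K : Finset (Fin 3 → ℤ), (0 : (Fin 3 → ℤ)) ∈ K ∧ (∀ x ∈ K, ξ ∈ Literature.Probability.Percolation.openConnIn ↑K 0 x) ∧ K.card ≤ n ^ 3 ∧ (n : ℝ) * ((↑(Literature.Probability.LatticeModels.edgeBoundary (Literature.Probability.LatticeModels.zdGraph 3) K) ∩ ξ : Set (Sym2 (Fin 3 → ℤ))).ncard : ℝ) ≤ c * K.card

-- `StationaryWeavingVanishingProfile` holds: proved by `Summit.CriticalPhenomena.PercolationContinuityZ3.Theorems.stationaryWeavingVanishingProfile_proof` @ d88b5d10243f (its module imports this route file, so no `_holds` link can be stated here).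

/-- item stmt-CriticalPhenomena-5263 · support · rank 9 · closed · proved by Summit.CriticalPhenomena.PercolationContinuityZ3.Theorems.isoperimetricClosing_proof @ 43aa0547366c (prover) · by planner
sources: CerfDembin2020, Grimmett1999
[support] second-leg assembly (provable now, ~120 lines): StationaryWeavingVanishingProfile →
CriticalConfigWeaves → SamePAnchoredIsoperimetry → PercolationContinuityZ3. Suppose theta* > 0 at p
= criticalProbI 3. P_{p_c} = bondPercolation (zdGraph 3) p_c is a translation-invariant probability
measure (product measure relabelled by the lattice shift; BondPercolationSymmetry / LatticeSymmetry
in tree) supported on edgeSet (setBernoulli on G.edgeSet), and WEAVE holds a.s.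
(CriticalConfigWeaves); so GenDembin gives a.s.: ∀ c > 0 ∀ N ∃ n ≥ N ∃ valid K with n|∂°K| ≤ c|K|.
On {C(0) infinite} (probability theta* > 0) SamePAnchoredIsoperimetry gives c0 > 0, N0 with c0|K| ≤
n|∂°K| for all valid K, n ≥ N0. With c := c0/2: c0|K| ≤ n|∂°K| ≤ (c0/2)|K| forces |K| = 0,
contradicting 0 ∈ K. Hence theta* = 0. -/
@[route_item "route-CriticalPhenomena-PercThresholdOne"]
def IsoperimetricClosing : Prop :=
  (∀ ν : MeasureTheory.Measure (Set (Sym2 (Fin 3 → ℤ))), MeasureTheory.IsProbabilityMeasure ν → (∀ (a : (Fin 3 → ℤ)) (A : Set (Set (Sym2 (Fin 3 → ℤ)))), MeasurableSet A → ν ((fun ξ => Sym2.map (· + a) ⁻¹' ξ) ⁻¹' A) = ν A) → (∀ᵐ ξ ∂ν, ξ ⊆ (Literature.Probability.LatticeModels.zdGraph 3).edgeSet ∧ (∀ (i : Fin 3) (k : ℤ) x, {y | ξ ∈ Literature.Probability.Percolation.openConnIn {z | k ≤ z i} x y}.Finite ∧ {y | ξ ∈ Literature.Probability.Percolation.openConnIn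 {z | z i ≤ k} x y}.Finite)) → ∀ᵐ ξ ∂ν, ∀ c : ℝ, 0 < c → ∀ N : ℕ, ∃ n : ℕ, N ≤ n ∧ ∃ K : Finset (Fin 3 → ℤ), (0 : (Fin 3 → ℤ)) ∈ K ∧ (∀ x ∈ K, ξ ∈ Literature.Probability.Percolation.openConnIn ↑K 0 x) ∧ K.card ≤ n ^ 3 ∧ (n : ℝ) * ((↑(Literature.Probability.LatticeModels.edgeBoundary (Literature.Probability.LatticeModels.zdGraph 3) K) ∩ ξ : Set (Sym2 (Fin 3 → ℤ))).ncard : ℝ) ≤ c * K.card) → (∀ᵐ ω ∂(Literature.Probability.Percolation.bondPercolation (Literature.Probability.LatticeModels.zdGraph 3) (Literature.Probability.Percolation.criticalProbI 3)), (∀ (i : Fin 3) (k : ℤ) x, {y | ω ∈ Literature.Probability.Percolation.openConnIn {z | k ≤ z i} x y}.Finite ∧ {y | ω ∈ Literature.Probability.Percolation.openConnIn {z | z i ≤ k} x y}.Finite)) → (∀ p : unitInterval, 0 < Literature.Probability.Percolation.theta (Literature.Probability.LatticeModels.zdGraph 3) 0 p → ∀ᵐ ω ∂(Literature.Probability.Percolation.bondPercolation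 (Literature.Probability.LatticeModels.zdGraph 3) p), (Literature.Probability.Percolation.openCluster ω 0).Infinite → ∃ c : ℝ, 0 < c ∧ ∃ N : ℕ, ∀ n : ℕ, N ≤ n → ∀ K : Finset (Fin 3 → ℤ), (0 : (Fin 3 → ℤ)) ∈ K → (∀ x ∈ K, ω ∈ Literature.Probability.Percolation.openConnIn ↑K 0 x) → K.card ≤ n ^ 3 → c * K.card ≤ (n : ℝ) * ((↑(Literature.Probability.LatticeModels.edgeBoundary (Literature.Probability.LatticeModels.zdGraph 3) K) ∩ ω : Set (Sym2 (Fin 3 → ℤ))).ncard : ℝ)) → PercolationContinuityZ3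

-- `IsoperimetricClosing` holds: proved by `Summit.CriticalPhenomena.PercolationContinuityZ3.Theorems.isoperimetricClosing_proof` @ 43aa0547366c (its module imports this route file, so no `_holds` link can be stated here).

/-- item stmt-CriticalPhenomena-5264 · support · rank 9 · closed · proved by Summit.CriticalPhenomena.PercolationContinuityZ3.Theorems.criticalConfigWeaves_proof @ f648441f8c8f (prover) · by planner
sources: BarskyGrimmettNewman1991, Grimmett1999
[support] WEAVING OF THE CRITICAL CONFIGURATION (provable now from PROVED facts, ~300 lines):
P_{p_c}-a.s., for every axis i, offset k and base point x, the sets {y | x <-> y by an open path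
inside {z | k ≤ z i}} and {y | x <-> y inside {z | z i ≤ k}} are finite (for x outside the
half-space the set is trivially finite). Proof: (a) by a countable union over (i, k, x) it suffices
to show each single set is a.s. finite; (b) lattice symmetries of bondPercolation (zdGraph 3) p
(LatticeSymmetry / BondPercolationSymmetry in tree: translations, coordinate permutations, the
reflection z_0 ↦ -z_0 are measure-preserving relabellings mapping open paths inside one half-space
to open paths inside the image half-space) reduce to the half-space ℍ = {z | 0 ≤ z 0} and a base
point x ∈ ℍ; (c) 'cluster of x by open paths inside ℍ is infinite' under bondPercolation (zdGraph 3)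
p has the probability theta ((zdGraph 3).induce ℍ) x p of percolation on the induced graph
(SubgraphMonotonicity.lean: restrictConfig, bondPercolation_map_comap,
reachable_map_of_restrictConfig / theta_comap_eq); (d) change of base point inside the connected
graph ℍ: for a fixed path γ from the origin to x inside ℍ, Harris (harr -/
@[route_item "route-CriticalPhenomena-PercThresholdOne"]
def CriticalConfigWeaves : Prop :=
  ∀ᵐ ω ∂(Literature.Probability.Percolation.bondPercolation (Literature.Probability.LatticeModels.zdGraph 3) (Literature.Probability.Percolation.criticalProbI 3)), (∀ (i : Fin 3) (k : ℤ) x, {y | ω ∈ Literature.Probability.Percolation.openConnIn {z | k ≤ z i} x y}.Finite ∧ {y | ω ∈ Literature.Probability.Percolation.openConnIn {z | z i ≤ k} x y}.Finite)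

-- `CriticalConfigWeaves` holds: proved by `Summit.CriticalPhenomena.PercolationContinuityZ3.Theorems.criticalConfigWeaves_proof` @ f648441f8c8f (its module imports this route file, so no `_holds` link can be stated here).

/-- item stmt-CriticalPhenomena-5265 · support · rank 9 · closed · proved by Summit.CriticalPhenomena.PercolationContinuityZ3.Theorems.thinningLaw_proof @ 5270a6c39a52 (prover) · by planner
sources: Grimmett1999, LyonsPeres2016
[support] THINNING OF THE MONOTONE COUPLING (provable now, ~120 lines): for p q ∈ [0,1], under
labelMeasure ⊗ P_q the configuration (configOfLabels p U (zdGraph 3)) ∩ eta has law P_{q·p} =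
bondPercolation (zdGraph 3) (q * p). Proof: both sides are product measures over edges (setBernoulli
= Measure.pi / infinitePi of Bernoulli): edge e ∈ E(Z^3) is present iff U_e ≤ p and e ∈ eta,
independent events of probabilities p and q, independently over e; identify via Measure.map of the
product of the two infinitePi measures (map_configOfLabels_holds gives the first factor's law; then
the coordinatewise AND of two independent Bernoulli product sets is Bernoulli(pq):
ProdBernoulliCoupling.lean / SprinkledCoupling.lean in tree have the sister statement for sprinkling
(OR)). This is the 'label-fragility identity' (card D5; LyonsPeres2016 Lemma 11.21 device):
Bernoulli(q) percolation ON omega_p is omega_{qp}. -/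
@[route_item "route-CriticalPhenomena-PercThresholdOne"]
def ThinningLaw : Prop :=
  ∀ p q : unitInterval, MeasureTheory.Measure.map (fun π : (Sym2 (Fin 3 → ℤ) → ℝ) × Set (Sym2 (Fin 3 → ℤ)) => Literature.Probability.Percolation.configOfLabels (p : ℝ) π.1 (Literature.Probability.LatticeModels.zdGraph 3) ∩ π.2) ((Literature.Probability.Percolation.labelMeasure (Fin 3 → ℤ)).prod (Literature.Probability.Percolation.bondPercolation (Literature.Probability.LatticeModels.zdGraph 3) q)) = Literature.Probability.Percolation.bondPercolation (Literature.Probability.LatticeModels.zdGraph 3) (q * p)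

-- `ThinningLaw` holds: proved by `Summit.CriticalPhenomena.PercolationContinuityZ3.Theorems.thinningLaw_proof` @ 5270a6c39a52 (its module imports this route file, so no `_holds` link can be stated here).

/-- item stmt-CriticalPhenomena-5266 · support · rank 9 · closed · proved by Summit.CriticalPhenomena.PercolationContinuityZ3.Theorems.FragileGiant.fragileWeavingGiantExists_proof @ 93d0593edb95 (prover) · by planner
sources: Pemantle1991, BenjaminiEtAl2001, LyonsPeres2016
[support] NEGATIVE FLOOR — THE DOSSIER WITHOUT ASSOCIATION IS CONSISTENT (true; needs UST facts not
in tree, so 'provable' only after vendoring Pemantle1991 / BenjaminiEtAl2001 as named facts —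
grounders may stamp it citeable+new-observation): there is a probability measure ν on n.n. bond
configurations of Z^3, invariant under translations, coordinate permutations and the reflection,
with a.s. UNIQ ∧ WEAVE, DENSE and FRAG — namely the uniform spanning tree T of Z^3. Checks: (1) T is
a.s. ONE tree (Pemantle1991, d ≤ 4) with ONE end (BenjaminiEtAl2001 / LyonsPeres2016 Thm 10.49):
UNIQ, DENSE = 1. (2) WEAVE: a half-space piece of T, if infinite, contains a ray, and all rays of a
one-ended tree share a tail with ray(0); the event {z_i bounded below along the end} is
translation-invariant, hence trivial (UST is mixing); if it had probability 1, reflection and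
permutation invariance would bound every coordinate along the end — impossible for an infinite
simple path; so every coordinate is unbounded in both directions along the end and no half-space
contains a tail: all pieces finite. (3) FRAG with exponential rate for EVERY q < 1: a q-open path
from 0 of tree-length m is the unique tree -/
@[route_item "route-CriticalPhenomena-PercThresholdOne"]
def FragileWeavingGiantExists : Prop :=
  ∃ ν : MeasureTheory.Measure (Set (Sym2 (Fin 3 → ℤ))), MeasureTheory.IsProbabilityMeasure ν ∧ (∀ g : (Fin 3 → ℤ) → (Fin 3 → ℤ), ((∃ a, g = (· + a)) ∨ (∃ σ : Equiv.Perm (Fin 3), g = fun x j => x (σ j)) ∨ g = fun x => Function.update x 0 (-x 0)) → ∀ A : Set (Set (Sym2 (Fin 3 → ℤ))), MeasurableSet A → ν ((fun ξ => Sym2.map g ⁻¹' ξ) ⁻¹' A) = ν A) ∧ (∀ᵐ ξ ∂ν, ξ ⊆ (Literature.Probability.LatticeModels.zdGraph 3).edgeSet ∧ (∀ x y, (Literature.Probability.Percolation.openCluster ξ x).Infinite → (Literature.Probability.Percolation.openCluster ξ y).Infinite → y ∈ Literature.Probability.Percolation.openCluster ξ x) ∧ (∀ (i : Fin 3) (k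 : ℤ) x, {y | ξ ∈ Literature.Probability.Percolation.openConnIn {z | k ≤ z i} x y}.Finite ∧ {y | ξ ∈ Literature.Probability.Percolation.openConnIn {z | z i ≤ k} x y}.Finite)) ∧ 0 < ν.real {ξ | (Literature.Probability.Percolation.openCluster ξ 0).Infinite} ∧ (∀ q : unitInterval, (q : ℝ) < 1 → ∃ c : ℝ, 0 < c ∧ ∀ n : ℕ, (ν.prod (Literature.Probability.Percolation.bondPercolation (Literature.Probability.LatticeModels.zdGraph 3) q)).real {π | π.1 ∩ π.2 ∈ Literature.Probability.Percolation.siteToBoundary 3 n} ≤ Real.exp (-c * n))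

-- `FragileWeavingGiantExists` holds: proved by `Summit.CriticalPhenomena.PercolationContinuityZ3.Theorems.FragileGiant.fragileWeavingGiantExists_proof` @ 93d0593edb95 (its module imports this route file, so no `_holds` link can be stated here).

/-- item stmt-CriticalPhenomena-5257 · assembly · rank 1 · closed · proved by Summit.CriticalPhenomena.PercolationContinuityZ3.Theorems.percThresholdOne_assembly_proof @ f0dfc2cd395a (prover) · by planner
sources: Grimmett1999, BarskyGrimmettNewman1991, DuminilCopinTassionCMP2016
[assembly] NoFragileGiantLocalRule → PercolationContinuityZ3 (~200 Lean lines given the supports;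
every input PROVED in tree). By percolationContinuityZ3_iff it suffices to refute theta* := theta
(zdGraph 3) 0 (criticalProbI 3) > 0. Take F U := configOfLabels (criticalProbI 3) U (zdGraph 3), R
:= 1. Hypotheses: Measurable (cylinder events), Antitone (U ≤ U' ⇒ {U' ≤ p} ⊆ {U ≤ p}), F U ⊆
edgeSet (by definition), equivariance (each listed g is a graph automorphism of zdGraph 3 = Hasse
graph of the product order: e ∈ edgeSet ↔ Sym2.map g e ∈ edgeSet), range 1 (e's status depends on U
e only and e's endpoints are within sup-distance 1: Probe `Pi.single 0 1 - 0 ∈ box 3 1`). FAS: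
transport along map_configOfLabels_holds ((labelMeasure).map F = P_{p_c}) of (i) UNIQ a.s. —
Grimmett1999_numInfiniteClusters_le_one_holds / BurtonKeane1989_atMostOneInfiniteCluster_holds +
reachable_of_numInfiniteClusters_le_one, (ii) WEAVE a.s. — support CriticalConfigWeaves. DENSE:
(labelMeasure).real {U | C_{F U}(0) infinite} = theta* > 0. Hence ¬FRAG. But FRAG holds: for q < 1,
{π | F π.1 ∩ π.2 ∈ siteToBoundary 3 n} has (labelMeasure ⊗ P_q)-probability = P_{q
p_c}(siteToBoundary 3 n) by ThinningLaw (Measure. -/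
@[route_item "route-CriticalPhenomena-PercThresholdOne"]
def Assembly : Prop :=
  (∀ (F : (Sym2 (Fin 3 → ℤ) → ℝ) → Set (Sym2 (Fin 3 → ℤ))) (R : ℕ), (Measurable F ∧ Antitone F ∧ (∀ U, F U ⊆ (Literature.Probability.LatticeModels.zdGraph 3).edgeSet) ∧ (∀ g : (Fin 3 → ℤ) → (Fin 3 → ℤ), ((∃ a, g = (· + a)) ∨ (∃ σ : Equiv.Perm (Fin 3), g = fun x j => x (σ j)) ∨ g = fun x => Function.update x 0 (-x 0)) → ∀ U, F (U ∘ Sym2.map g) = Sym2.map g ⁻¹' F U)) → (∀ U U' e, (∀ f, (∀ x ∈ e, ∀ y ∈ f, y - x ∈ Literature.Probability.LatticeModels.box 3 R) → U f = U' f) → (e ∈ F U ↔ e ∈ F U')) → (∀ᵐ U ∂(Literature.Probability.Percolation.labelMeasure (Fin 3 → ℤ)), (∀ x y, (Literature.Probability.Percolation.openCluster (F U) x).Infinite → (Literature.Probability.Percolation.openCluster (F U) y).Infinite → y ∈ Literature.Probability.Percolation.openCluster (F U) x) ∧ (∀ (i : Fin 3) (k : ℤ) x, {y | (F U) ∈ Literature.Probability.Percolation.openConnIn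 {z | k ≤ z i} x y}.Finite ∧ {y | (F U) ∈ Literature.Probability.Percolation.openConnIn {z | z i ≤ k} x y}.Finite)) → 0 < (Literature.Probability.Percolation.labelMeasure (Fin 3 → ℤ)).real {U | (Literature.Probability.Percolation.openCluster (F U) 0).Infinite} → ¬ (∀ q : unitInterval, (q : ℝ) < 1 → ∃ c : ℝ, 0 < c ∧ ∀ n : ℕ, ((Literature.Probability.Percolation.labelMeasure (Fin 3 → ℤ)).prod (Literature.Probability.Percolation.bondPercolation (Literature.Probability.LatticeModels.zdGraph 3) q)).real {π | F π.1 ∩ π.2 ∈ Literature.Probability.Percolation.siteToBoundary 3 n} ≤ Real.exp (-c * n))) → PercolationContinuityZ3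

-- `Assembly` holds: proved by `Summit.CriticalPhenomena.PercolationContinuityZ3.Theorems.percThresholdOne_assembly_proof` @ f0dfc2cd395a (its module imports this route file, so no `_holds` link can be stated here).

/-! D-0027 §2.1 — DECIDING THEOREM (planner-authored via `route open/edit --closes-file`; by planner-rbadge-CriticalPhenomena-PercThreshold-ba14fe27-g4-0 2026-08-15T16:09:47Z):
its hypotheses are this route's items and its conclusion the sub-problem Statement (glue_lint), and it elaborates with this file. -/

@[closes "route-CriticalPhenomena-PercThresholdOne"] theorem closes (h_NoFragileGiantLocalRule : NoFragileGiantLocalRule) (h_Assembly : Assembly) :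
    _root_.PercolationContinuityZ3 :=
  h_Assembly h_NoFragileGiantLocalRule

end Summit.CriticalPhenomena.PercolationContinuityZ3.Theses.PercThresholdOne
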